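/-
Copyright (c) 2026. All rights reserved.
Released under Apache 2.0 license as described in the file LICENSE.
Authors: abc-iut cell, F-lane seat abc-iut-f-187 (gen 3), KEY INST59L2.
-/
import Literature.AnabelianGeometry.SemiGraphs.ArithmeticCurvesRmk561Closures
import HarnessLib

/-!
# [SemiAnbd] Rmk. 5.6.1 `Rmk561RigidityStatement` (FACT-LIST F-1369): INSTANCE FORMS — the closed instance at the
# empty origin certificate, and a NON-VACUOUS certified-tower witness (proof-only)

S. Mochizuki, *Semi-graphs of anabelioids*, Publ. RIMS **42** (2006), §5, Remark 5.6.1 p. 68 (with Example 5.6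
pp. 67–68): "there is an immediate profinite generalization of the group-theoretic reconstruction in Example 5.6 of the
generalized morphism `𝔊^c_i → 𝔊^c_j` from the corresponding morphism of profinite groups `M_i^∧ → M_j^∧`".
[cite: MochizukiSemiAnbd2006, Rmk 5.6.1, p. 68]

PROOF-ONLY companion (no `def`, no `structure`, no `instance`, no notation; every model object lives inside a proof or a
statement) of abc-iut-L3-t3's `ArithmeticCurves.lean`, where the remark is typed in RIGIDITY FORM, guarded by the cell's
ORIGIN CERTIFICATE `Ω : StableReductionOrigin 𝓥 K` (an uninterpreted parameter: André's `π₁^temp`, stable reduction):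
for towers `T`, `T'` certified by `Ω.IsStableReductionTowerOf`, an isomorphism of profinite completions over `G_K`
matching the closures of the `M_i` comes with isomorphisms `𝔊^c_i ⥲ 𝔊'^c_i` compatible with the specialisation maps.

Bookkeeping context (cell abc-iut, KEY row INST59L2).  The row is a SCHEMA in `Ω` (and `𝓥`, `K`): its universal closure
is REFUTED in the tree at the VACUOUS certificate (`exists_origin_not_rmk561RigidityStatement`,
`not_forall_rmk561RigidityStatement`; abc-iut-f-157, `ArithmeticCurvesRmk561Closures.lean`), and its only positive
form is the CONDITIONAL closer `rmk561RigidityStatement_of_forall_not_certified` (hypothesis: the certificate certifies no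
tower).  The L-F kernel census found NO instance form.  This file records:

* `rmk561RigidityStatement_emptyCertificate` — **CLOSED INSTANCE over every container `𝓥` and base field `K`** (type /
  instance / data binders only) at the literal EMPTY origin certificate (nothing is of geometric origin, no tower is
  certified).  HONEST LABEL: VACUOUS — the certified-tower quantifier is empty; recorded as the 0-hypothesis form of the
  existing conditional closer, not as content;
* `exists_certifying_origin_rmk561RigidityStatement` — **NON-VACUOUS `∃`-WITNESS (0 binders)**: over `K = ℚ̄` (so
  `G_K = 1`) and the toy container of the closures file on the discrete category on `Bool`, the certificate «every
  compactified level `𝔊^c_i` sits on the object `true` and has `π̂₁(A) = 1`» CERTIFIES a tower (the constant tower of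
  `StableReductionTower.exists_const` on the trivial arithmetic semi-graph of `ArithSemiGraph.exists_trivial_on`) AND
  `Rmk561RigidityStatement` HOLDS at it: between any two certified towers the levels are isomorphic by
  `(1, eqToHom) : 𝔊^c_i ⥲ 𝔊'^c_i` (trivial arithmetic component, the unique arrow of the discrete category), compatibly
  with the specialisation maps (their target `Vert ⊕ Edge` is a one-element type).  HONEST LABEL: «INSTANCE at toy
  carrier» — DEGENERATE (`Π = 1`, one vertex, no edge); it shows the typed rigidity form is satisfiable by a certificate
  that certifies something, nothing more;
* `rmk561RigidityStatement_instances_both_ways` — the R5 record next to the tree's refutation.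

The GENUINE instance (André's tempered fundamental group of a hyperbolic curve over an MLF and its stable-reduction
tower) is not constructible in the tree (FOUNDATIONS rows 13–14 of the cell); there the row is the printed anabelian
statement ([SemiAnbd] Rmk 5.6.1 via [Mzk3] Lem. 2.3) and stays a NAMED hypothesis.  Refuted-as-schema ≠
refuted-in-print; instantiated ≠ endorsed; typed ≠ proved; no bearing on [IUTchIII] Cor. 3.12; nothing about abc.
-/

namespace Literature.AnabelianGeometry.SemiGraphs

open _root_.CategoryTheory Literature.AlgebraicGeometry.Frobenioids

universe u v w u'

/-! ### The closed instance at the empty certificate -/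

/-- **F-1369, CLOSED INSTANCE at the EMPTY origin certificate** (VACUOUS, labelled): over every container `𝓥` and
every base field `K`, the certificate declaring NO tempered group of geometric origin and certifying NO tower satisfies
[SemiAnbd] Rmk 5.6.1 (rigidity form) as typed — the certified-tower quantifier is empty
(`rmk561RigidityStatement_of_forall_not_certified`).  All content of the row sits in the certificate.
[cite: MochizukiSemiAnbd2006, Rmk 5.6.1, p. 68] -/
theorem rmk561RigidityStatement_emptyCertificate {Obj : Type u} [Category.{v} Obj]
    (𝓥 : SemiAnbdVocab.{u, v, w} Obj) (K : Type u') [Field K] :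
    Literature.AnabelianGeometry.SemiGraphs.Rmk561RigidityStatement
      ({ IsOfGeometricOrigin := fun _ => False
         IsTateOrigin := fun _ => False
         isOfGeometricOrigin_of_isTateOrigin := fun _ h => h
         IsStableReductionTowerOf := fun _ _ => False
         isOfGeometricOrigin_of_isStableReductionTowerOf := fun _ _ h => h } : StableReductionOrigin 𝓥 K) :=
  rmk561RigidityStatement_of_forall_not_certified _ fun _ _ h => h

/-! ### A certificate that certifies a tower and satisfies the rigidity statement -/

/-- **F-1369, NON-VACUOUS `∃`-WITNESS at a toy carrier (labelled)**: over `K = ℚ̄` and the toy container on the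
discrete category on `Bool` (`SemiAnbdVocab.exists_discreteBool_vocab`: one vertex, no edge per object), the origin
certificate «every compactified level `𝔊^c_i` lies on the object `true` and has trivial `π̂₁(A)`» (all `D` declared of
geometric origin) CERTIFIES SOME TOWER — the constant tower over the degenerate tempered group `Π = G_{ℚ̄} = 1` — and
[SemiAnbd] Rmk 5.6.1 (rigidity form) HOLDS at it: for certified `T`, `T'` the levels are isomorphic by the pair
(trivial homomorphism `1 → 1`, the unique arrow `eqToHom`), compatibly with the specialisation maps (valued in the
one-element type `Vert ⊕ Edge`).  DEGENERATE; a satisfiability statement about OUR typing, not the printed remark.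
[cite: MochizukiSemiAnbd2006, Rmk 5.6.1, p. 68] -/
theorem exists_certifying_origin_rmk561RigidityStatement :
    ∃ (𝓥 : SemiAnbdVocab.{0, 0, 0} (Discrete Bool)) (Ω : StableReductionOrigin 𝓥 (AlgebraicClosure ℚ)),
      (∃ (D : TemperedArithmeticGroup (AlgebraicClosure ℚ)) (T : StableReductionTower 𝓥 D),
          Ω.IsStableReductionTowerOf D T) ∧
        Literature.AnabelianGeometry.SemiGraphs.Rmk561RigidityStatement Ω := by
  obtain ⟨𝓥, h𝓥⟩ := SemiAnbdVocab.exists_discreteBool_vocab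
  refine ⟨𝓥,
    { IsOfGeometricOrigin := fun _ => True
      IsTateOrigin := fun _ => True
      isOfGeometricOrigin_of_isTateOrigin := fun _ _ => trivial
      IsStableReductionTowerOf := fun _ T =>
        ∀ i, (T.𝔊c i).G = (⟨true⟩ : Discrete Bool) ∧ Subsingleton (T.𝔊c i).PA
      isOfGeometricOrigin_of_isStableReductionTowerOf := fun _ _ _ => trivial }, ?_, ?_⟩
  · -- a certified tower exists: the constant tower on the trivial arithmetic semi-graph over the object `true`
    obtain ⟨𝔊t, hGt, ht⟩ := ArithSemiGraph.exists_trivial_on ⟨true⟩ (h𝓥 _).1 (h𝓥 _).2.1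
      (h𝓥 _).2.2.1 (h𝓥 _).2.2.2.1 (h𝓥 _).2.2.2.2
    haveI := ht
    obtain ⟨D, hD⟩ := TemperedArithmeticGroup.exists_subsingleton_of_isAlgClosed (AlgebraicClosure ℚ)
    haveI := hD
    haveI : Subsingleton (Field.absoluteGaloisGroup (AlgebraicClosure ℚ)) := D.aug_surjective.subsingleton
    obtain ⟨T, -, hT⟩ := StableReductionTower.exists_const 𝓥 D 𝔊t 𝔊t
    exact ⟨D, T, fun i => ⟨by rw [hT i]; exact hGt, by rw [hT i]; exact ht⟩⟩
  · -- the rigidity statement holds between any two certified towers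
    intro D D' _ _ T T' hT hT' P P' ι ι' augP augP' _ _ _ _ α _ _
    have hVE : ∀ X : Discrete Bool, Subsingleton (𝓥.Vert X ⊕ 𝓥.Edge X) := fun X => by
      haveI := (h𝓥 X).2.2.1
      haveI := (h𝓥 X).2.2.2.1
      refine ⟨?_⟩
      rintro (a | a) (b | b)
      · exact congrArg Sum.inl (Subsingleton.elim _ _)
      · exact isEmptyElim b
      · exact isEmptyElim a
      · exact isEmptyElim a
    refine ⟨fun i =>
      { arith := 1
        continuous_arith := by
          haveI := (hT' i).2
          exact continuous_of_const fun _ _ => Subsingleton.elim _ _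
        geom := eqToHom ((hT i).1.trans (hT' i).1.symm)
        compat := fun _ => Subsingleton.elim _ _ }, fun i => ⟨inferInstance, ?_⟩, fun i j h => ⟨?_, ?_⟩⟩
    · -- the arithmetic component `1 → 1` is bijective
      haveI := (hT i).2
      haveI := (hT' i).2
      exact ⟨Function.injective_of_subsingleton _, fun y => ⟨1, Subsingleton.elim _ _⟩⟩
    · intro v
      haveI := hVE (T'.𝔊c j).G
      exact Subsingleton.elim _ _
    · intro e
      haveI := (h𝓥 (T.𝔊c i).G).2.2.1
      exact isEmptyElim e

/-- **R5 record for F-1369**: [SemiAnbd] Rmk 5.6.1 (rigidity form) as typed HOLDS at a certificate that certifies a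
tower (above) and FAILS at the vacuous certificate (`exists_origin_not_rmk561RigidityStatement`), over the same
container and base field — the row is decided by the certificate and is consumable at named instances only.
[cite: MochizukiSemiAnbd2006, Rmk 5.6.1, p. 68] -/
theorem rmk561RigidityStatement_instances_both_ways :
    (∃ (𝓥 : SemiAnbdVocab.{0, 0, 0} (Discrete Bool)) (Ω : StableReductionOrigin 𝓥 (AlgebraicClosure ℚ)),
        (∃ (D : TemperedArithmeticGroup (AlgebraicClosure ℚ)) (T : StableReductionTower 𝓥 D),
            Ω.IsStableReductionTowerOf D T) ∧
          Literature.AnabelianGeometry.SemiGraphs.Rmk561RigidityStatement Ω) ∧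
      ∃ (𝓥 : SemiAnbdVocab.{0, 0, 0} (Discrete Bool)) (Ω : StableReductionOrigin 𝓥 (AlgebraicClosure ℚ)),
        ¬ Literature.AnabelianGeometry.SemiGraphs.Rmk561RigidityStatement Ω :=
  ⟨exists_certifying_origin_rmk561RigidityStatement, exists_origin_not_rmk561RigidityStatement⟩

end Literature.AnabelianGeometry.SemiGraphs
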